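import Literature.AlgebraicGeometry.ModuliOfAbelianVarieties.SiegelAdmissibleFrameGram
import Literature.AlgebraicGeometry.ModuliOfAbelianVarieties.SiegelPairingReadOfTypeFrame
import Literature.AlgebraicGeometry.Motives.ComplexTorusHomEquivalence
import Literature.AlgebraicGeometry.Motives.AbelianVarietyAmpleRiemannForm
import Literature.AlgebraicGeometry.HodgeTheory.AbelianVarietyUniformisationPicard
import Literature.Geometry.Kaehler.ComplexTorusPicardPullback
import Literature.Geometry.Kaehler.ComplexTorusZarhinTrick
import Literature.Geometry.Kaehler.ComplexTorusLift
import HarnessLib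

/-!
# (β3F) «TYPE FRAME OF THE HECKE ISOGENY QUOTIENT'S POLARISATION» — F2 (AH transport along the torus isogeny) + F3
# (the `γ`-moved frame), from the algebraic polarisation clause «`ψ^*Θ_Q ≡ ν•Θ′` modulo `Pic⁰`»
# ([Milne 2005] Thm. 6.11; [Lange 2023] §1.3.3 Lemma 1.3.6, §1.4.2 Prop. 1.4.6 (d), §3.1)

Topic `AlgebraicGeometry/ModuliOfAbelianVarieties`; namespace `Literature.AlgebraicGeometry.ModuliOfAbelianVarieties`.
KERNEL ONLY: theorems; no definition, no named fact, no instance, no `sorry`.  Cell hodgecm-mathlib, Hecke-link socket (B),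
Route F (B-plan1 (g14) 20:04:44Z), hands (F2) B-p14 (this file's §1–§2) and (F3) (the last matrix step, done here too).

SETTING.  `ψ : A′ → B` a dominant homomorphism of complex abelian varieties (the Hecke quotient at one complex point);
markings with UNIT basis matrix `m` of `A′` by `[J(Z), r′]` and `m_B` of `B` by `[J(Z′), r]`, `r, r′ ∈ K_δ(1)`, related by
`u_B(v) = ψ(u(γ⁻¹ v))`; the source datum (ample `Θ′` with `λ̄′ = Λ(𝒪(Θ′))` of type `δ`, a symplectic lift `Λ′` matched to
`m` through `r′`) — so ★ `exists_ahData_intGram_eq_typeForm_of_symplecticLift` FRAMES THE SOURCE: `intGram m.Ψ p′.form =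
typeForm δ`; a divisor `Θ` on `B`; the similitude clause (QA3) `ᵗγ E_δ γ = ν E_δ`; and the POLARISATION CLAUSE in divisorial
form (W‴): every translate of `ψ^*Θ − ν•Θ′` is linearly equivalent to it (`K(ψ^*Θ − νΘ′) = A′`, i.e. `φ_{ψ^*Θ} = φ_{νΘ′}`,
[MumfordAV1970] §8; this is what `ψ̂ ∘ λ_B ∘ ψ = ν•λ′` says about the `Λ(𝒪(·))`-witnesses).

* §1 `map_intCast_eq_of_quotientMarking` — GAGA's integer matrix `M` of `ψ` between the two uniformisations IS `γ`
  (`u_B = ψ ∘ u ∘ γ⁻¹` on the dense rational points, ★ `mapMatrix_proj`, injectivity of `m_B.toFun`, `proj_eq_proj_iff`).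
* §2 `quotient_typeFrame` — THE (β3F) SOCKET of `BetaSockets.v2` in the (W‴) currency: `∃ p_B : AHData m_B.Ψ,
  toPic p_B = [𝒪_B(Θ)^an] ∧ intGram m_B.Ψ p_B.form = typeForm δ`.  Proof: `[𝒪_{A′}(ψ^*Θ)^an] = f^*[𝒪_B(Θ)^an]`
  (★ `picClass_cartierDivisorLineBundle_pullback_hom`), so `c₁(ψ^*Θ) = F^*c₁(Θ)` (★ `Pic.nsForm_pullback`); (W‴) ⇒
  `[𝒪(ψ^*Θ − νΘ′)^an] ∈ Pic⁰` (★ `picClass_cartierDivisorLineBundle_mem_picZero`) ⇒ `F^*c₁(Θ) = ν•c₁(Θ′)`; Gram matrices: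
  `ᵗM G_B M = ν E_δ` (★ `latticeGram_pullbackForm_of_real`, ★ `map_intGram`, the source frame); `M = γ` (§1) and (QA3)
  `ᵗγ E_δ γ = ν E_δ` give `G_B = E_δ` (`γ` invertible).

## References
* [Milne2005ShimuraVarieties] §6 Thm. 6.11 pp. 74–75.
* [Lange2023AbelianVarietiesComplex] §1.1.2 Prop. 1.1.6 (p. 8); §1.3.3 Lemma 1.3.6 (p. 32); §1.4.2 Prop. 1.4.6 (d); §3.1.
* [MumfordAV1970] §8 (the divisor class `t_x^*D − D`, `K(D)`).
HC_CM is proved only modulo the 7 printed citations until rung 0 closes; this file discharges none of them.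
-/

set_option autoImplicit false

noncomputable section

open CategoryTheory AlgebraicGeometry Matrix Function
open scoped Manifold
open Literature.AlgebraicGeometry.Motives (AbelianVariety AlgPoints CartierDivisor specOver ComplexPoints)
open Literature.AlgebraicGeometry.AbelianSchemes (AbelianSchemeOver PolarizedAbelianSchemeWithLevel)
open Literature.Geometry.Kaehler
open Literature.Geometry.Kaehler.ComplexTorus
open Literature.NumberTheory.Transcendental (IsAnalytification)
open Literature.AlgebraicGeometry.HodgeTheory
open Literature.NumberTheory.Adeles
open Literature.NumberTheory.Automorphic (siegelUpperHalfSpace)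

namespace Literature.AlgebraicGeometry.ModuliOfAbelianVarieties

open SiegelModuli

variable {g : ℕ} {δ : Fin g → ℕ}

/-! ### §0 Two private copies of the hom-pullback naturality (★ `HodgeTheory.CartierDivisorLineBundleHomPullback`, in flight) -/

section HomPullback

variable {ι ι' : Type} [Fintype ι] [Fintype ι'] {E E' : Type} [NormedAddCommGroup E] [NormedSpace ℂ E]
  [FiniteDimensional ℂ E] [NormedAddCommGroup E'] [NormedSpace ℂ E'] [FiniteDimensional ℂ E'] {A A' : AbelianVariety ℂ}
  {Φ : (ι → ℝ) ≃L[ℝ] E} {Φ' : (ι' → ℝ) ≃L[ℝ] E'}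
  {φ : ComplexTorus Φ → ComplexPoints A.X} {φ' : ComplexTorus Φ' → ComplexPoints A'.X}
  (hφ : IsAnalytification E A.X A.dim φ) (hφ' : IsAnalytification E' A'.X A'.dim φ')

/-- Two holomorphic line bundles with the same trivialising sets and transition functions are equal (private helper).
[folklore] -/
private theorem holomorphicLineBundle_ext'
    {κ : Type*} {E₀ : Type*} [NormedAddCommGroup E₀] [NormedSpace ℂ E₀] {M₀ : Type*} [TopologicalSpace M₀]
    [ChartedSpace E₀ M₀] {L L' : HolomorphicLineBundle κ E₀ M₀} (h₁ : L.baseSet = L'.baseSet)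
    (h₂ : L.coordChange = L'.coordChange) : L = L' := by
  cases L; cases L'; cases h₁; cases h₂; rfl

/-- `𝒪_A(u^*D)^an = (M·)^* 𝒪_{A′}(D)^an` on the nose (private copy of ★-in-flight
`HodgeTheory.cartierDivisorLineBundle_pullback_hom`). [cite: GortzWedhorn2020, Def. 11.49 and Prop. 11.50 (p. 315)] -/
private theorem cartierDivisorLineBundle_pullback_hom' (u : A ⟶ A') [IsDominant u.hom.hom.hom.left] (M : Matrix ι' ι ℤ)
    (hM : ∀ x, φ' (mapMatrix Φ Φ' M x) = AlgPoints.map u.hom.hom.hom (φ x))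
    (hdiff : MDifferentiable 𝓘(ℂ, E) 𝓘(ℂ, E') (mapMatrix Φ Φ' M))
    (D : CartierDivisor A'.X.left) :
    cartierDivisorLineBundle hφ (D.pullback u.hom.hom.hom.left) =
      (cartierDivisorLineBundle hφ' D).pullback (mapMatrix Φ Φ' M) hdiff := by
  refine holomorphicLineBundle_ext' ?_ ?_
  · funext i
    ext s
    show u.hom.hom.hom.left (φ s).pt ∈ D.U i ↔ (φ' (mapMatrix Φ Φ' M s)).pt ∈ D.U i
    rw [hM, AlgPoints.pt_map]
  · funext i j s
    show AlgPoints.evalOrZero ((D.pullback u.hom.hom.hom.left).U j ⊓ (D.pullback u.hom.hom.hom.left).U i)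
        ((D.pullback u.hom.hom.hom.left).transFun j i) (φ s) =
      AlgPoints.evalOrZero (D.U j ⊓ D.U i) (D.transFun j i) (φ' (mapMatrix Φ Φ' M s))
    rw [CartierDivisor.evalOrZero_transFun_pullback, hM]

/-- `[𝒪_A(u^*D)^an] = f^*[𝒪_{A′}(D)^an]` (private copy of ★-in-flight `HodgeTheory.picClass_cartierDivisorLineBundle_pullback_hom`).
[cite: Lange2023AbelianVarietiesComplex, §1.3.3 Lemma 1.3.6, p. 32] -/
private theorem picClass_cartierDivisorLineBundle_pullback_hom' (u : A ⟶ A') [IsDominant u.hom.hom.hom.left]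
    (M : Matrix ι' ι ℤ) {F : E →L[ℂ] E'} (hF : ∀ x, Φ' ((M.map (Int.cast : ℤ → ℝ)).mulVec x) = F (Φ x))
    (hM : ∀ x, φ' (mapMatrix Φ Φ' M x) = AlgPoints.map u.hom.hom.hom (φ x))
    (D : CartierDivisor A'.X.left) :
    picClass (cartierDivisorLineBundle hφ (D.pullback u.hom.hom.hom.left)) =
      Pic.pullback Φ Φ' hF (picClass (cartierDivisorLineBundle hφ' D)) := by
  rw [cartierDivisorLineBundle_pullback_hom' hφ hφ' u M hM (mdifferentiable_mapMatrix_of_analyticRep Φ Φ' hF) D]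
  exact picClass_pullback_mapMatrix Φ Φ' hF _ _

omit [Fintype ι] [FiniteDimensional ℂ E] in
/-- The algebraic translation acts as the torus translation under a uniformisation compatible with the group laws
(general model space; ★ `map_translation_uniformisation` is the `Fin A.dim → ℂ` case). [cite: GortzWedhorn2023, Def. 27.1 (p. 604)] -/
private theorem map_translation_uniformisation' (hadd : ∀ x y, φ (x + y) = φ x * φ y) (t s : ComplexTorus Φ) :
    AlgPoints.map (A.translation (φ t)) (φ s) = φ (s + t) := by
  rw [AlgPoints.map_apply, AbelianVariety.comp_translation, hadd, mul_comm]

/-- `𝒪_A(t_x^* D)^an = (t^an)^* 𝒪_A(D)^an` on the nose (general model space; ★ `cartierDivisorLineBundle_pullback_translation`).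
[cite: GortzWedhorn2020, Def. 11.49 and Prop. 11.50 (p. 315)] -/
private theorem cartierDivisorLineBundle_pullback_translation' (hadd : ∀ x y, φ (x + y) = φ x * φ y)
    (D : CartierDivisor A.X.left) (t : ComplexTorus Φ) :
    cartierDivisorLineBundle hφ (D.pullback (A.translation (φ t)).left) =
      (cartierDivisorLineBundle hφ D).pullback (fun s ↦ s + t) (mdifferentiable_add_const Φ t) := by
  refine holomorphicLineBundle_ext' ?_ ?_
  · funext i
    ext s
    show (A.translation (φ t)).left (φ s).pt ∈ D.U i ↔ (φ (s + t)).pt ∈ D.U i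
    rw [← map_translation_uniformisation' hadd t s, AlgPoints.pt_map]
  · funext i j s
    show AlgPoints.evalOrZero ((D.pullback (A.translation (φ t)).left).U j ⊓ (D.pullback (A.translation (φ t)).left).U i)
        ((D.pullback (A.translation (φ t)).left).transFun j i) (φ s) =
      AlgPoints.evalOrZero (D.U j ⊓ D.U i) (D.transFun j i) (φ (s + t))
    rw [CartierDivisor.evalOrZero_transFun_pullback, map_translation_uniformisation' hadd]

/-- A translation-invariant divisor class analytifies into `Pic⁰` (general model space; ★
`picClass_cartierDivisorLineBundle_mem_picZero` is the `Fin A.dim → ℂ` case). [cite: MumfordAV1970, §8 ((iv) ⇒ (i))]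
[cite: Lange2023AbelianVarietiesComplex, §1.4.1 Prop. 1.4.1 and §1.4.2] -/
private theorem picClass_cartierDivisorLineBundle_mem_picZero' [DecidableEq ι] (hadd : ∀ x y, φ (x + y) = φ x * φ y)
    (D : CartierDivisor A.X.left) (hD : ∀ x : A.Points ℂ, (D.pullback (A.translation x).left).LinEquiv D) :
    picClass (cartierDivisorLineBundle hφ D) ∈ picZero Φ := by
  refine mem_picZero_of_forall_translate_eq fun t ↦ ?_
  obtain ⟨u, rfl⟩ : ∃ u, cover Φ u = t := ⟨_, cover_apply_lift t⟩
  rw [← picClass_pullback_add_cover (cartierDivisorLineBundle hφ D) u (mdifferentiable_add_const Φ _),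
    ← cartierDivisorLineBundle_pullback_translation' hφ hadd D (cover Φ u)]
  exact picClass_cartierDivisorLineBundle_eq_of_linEquiv hφ (hD (φ (cover Φ u)))

end HomPullback

/-! ### §1 GAGA's matrix of `ψ` between the two markings is `γ` -/

/-- A rational matrix mapping every rational vector into `ℤ^n` is zero (private helper). [folklore] -/
private theorem eq_zero_of_forall_mulVec_int {n : Type} [Fintype n] [DecidableEq n] (N : Matrix n n ℚ)
    (h : ∀ v : n → ℚ, ∃ z : n → ℤ, N *ᵥ v = fun i => (z i : ℚ)) : N = 0 := by
  ext i j
  rw [Matrix.zero_apply]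
  by_contra hij
  obtain ⟨z, hz⟩ := h (Pi.single j (1 / (2 * N i j)))
  have h1 : (N *ᵥ Pi.single j (1 / (2 * N i j))) i = N i j * (1 / (2 * N i j)) := by
    simp only [Matrix.mulVec, dotProduct, Pi.single_apply, mul_ite, mul_zero, Finset.sum_ite_eq',
      Finset.mem_univ, if_true]
  have h2 : N i j * (1 / (2 * N i j)) = 1 / 2 := by field_simp
  rw [h2, hz] at h1
  have h1' : (z i : ℚ) = 1 / 2 := h1
  have h3 : (2 : ℚ) * (z i : ℚ) = 1 := by rw [h1']; norm_num
  have h4 : (2 : ℤ) * z i = 1 := by exact_mod_cast h3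
  omega

/-- **GAGA's integer matrix of the quotient map IS `γ`.**  If `m` (`m.γ = 1`) marks `A′`, `m_B` (`m_B.γ = 1`) marks `B`,
`u_B(v) = ψ(u(γ⁻¹ v))` for all rational `v`, and `M` is the integer matrix of `ψ` between the two uniformisations
(`m_B.toFun (M s̄) = ψ(m.toFun s̄)`, ★ `exists_mem_homInt_map_eq`), then `M = γ` (so `γ` is integral).  Proof: on rational points
`m_B.toFun [v] = m_B.toFun [Mγ⁻¹ v]` (★ `r_eq_toFun_proj_of_γ_eq_one`, ★ `mapMatrix_proj`), `m_B.toFun` is injective, so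
`(Mγ⁻¹ − 1)v ∈ ℤ^{2g}` for every rational `v`, whence `Mγ⁻¹ = 1`. [cite: Lange2023AbelianVarietiesComplex, §1.1.2 Prop. 1.1.6, p. 8]
[cite: Milne2005ShimuraVarieties, §6 Thm. 6.11 p. 74 and p. 75] -/
theorem map_intCast_eq_of_quotientMarking (hδ : IsPolarizationType δ) {Z Z' : Matrix (Fin g) (Fin g) ℂ}
    (hZ : Z ∈ siegelUpperHalfSpace g) (hZ' : Z' ∈ siegelUpperHalfSpace g) {r r' : gspFinAdelic δ}
    (γq : GL (Fin g ⊕ Fin g) ℚ) {A B : AbelianVariety ℂ}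
    (m : SiegelAdelicMarking ⟨jOfSiegel δ Z, SiegelComplexRecordSystem.jOfSiegel_mem_C0pm hδ.1 hZ⟩ r' A) (hmγ : m.γ = 1)
    (mB : SiegelAdelicMarking ⟨jOfSiegel δ Z', SiegelComplexRecordSystem.jOfSiegel_mem_C0pm hδ.1 hZ'⟩ r B) (hmBγ : mB.γ = 1)
    (ψ : A ⟶ B)
    (hmB : ∀ v : Fin g ⊕ Fin g → ℚ, mB.r v = AlgPoints.map ψ.hom.hom.hom
        (m.r ((((γq⁻¹ : GL (Fin g ⊕ Fin g) ℚ) : Matrix (Fin g ⊕ Fin g) (Fin g ⊕ Fin g) ℚ)) *ᵥ v)))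
    {M : Matrix (Fin g ⊕ Fin g) (Fin g ⊕ Fin g) ℤ}
    (hM : ∀ x, mB.toFun (mapMatrix m.Ψ mB.Ψ M x) = AlgPoints.map ψ.hom.hom.hom (m.toFun x)) :
    M.map (Int.cast : ℤ → ℚ) = (γq : Matrix (Fin g ⊕ Fin g) (Fin g ⊕ Fin g) ℚ) := by
  set γi : Matrix (Fin g ⊕ Fin g) (Fin g ⊕ Fin g) ℚ :=
    ((γq⁻¹ : GL (Fin g ⊕ Fin g) ℚ) : Matrix (Fin g ⊕ Fin g) (Fin g ⊕ Fin g) ℚ) with hγi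
  -- `N := M γ⁻¹ − 1` maps rational vectors into `ℤ^{2g}`
  have hN : ∀ v : Fin g ⊕ Fin g → ℚ, ∃ z : Fin g ⊕ Fin g → ℤ,
      (M.map (Int.cast : ℤ → ℚ) * γi - 1) *ᵥ v = fun i => (z i : ℚ) := by
    intro v
    have h1 : mB.toFun (proj mB.Ψ fun i => ((v i : ℚ) : ℝ)) =
        mB.toFun (proj mB.Ψ ((M.map (Int.cast : ℤ → ℝ)) *ᵥ fun i => (((γi *ᵥ v) i : ℚ) : ℝ))) := by
      rw [← mB.r_eq_toFun_proj_of_γ_eq_one hmBγ, hmB v, m.r_eq_toFun_proj_of_γ_eq_one hmγ, ← hM, mapMatrix_proj]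
    have h2 := mB.isAnalytification.isHomeomorph.injective h1
    obtain ⟨n, hn⟩ := proj_eq_proj_iff.1 h2
    refine ⟨n, ?_⟩
    funext i
    have hni := congr_fun hn i
    simp only [Pi.add_apply] at hni
    -- `(M_ℝ · w̄) i` is the cast of `(M_ℚ · w) i`
    have hcast : ((M.map (Int.cast : ℤ → ℝ)) *ᵥ fun j => (((γi *ᵥ v) j : ℚ) : ℝ)) i =
        (((M.map (Int.cast : ℤ → ℚ) *ᵥ (γi *ᵥ v)) i : ℚ) : ℝ) := by
      simp only [Matrix.mulVec, dotProduct, Matrix.map_apply]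
      push_cast
      rfl
    have h' : ((M.map (Int.cast : ℤ → ℚ) * γi - 1) *ᵥ v) i =
        (M.map (Int.cast : ℤ → ℚ) *ᵥ (γi *ᵥ v)) i - v i := by
      rw [Matrix.sub_mulVec, Matrix.one_mulVec, ← Matrix.mulVec_mulVec]; rfl
    rw [h']
    have hreal : ((((M.map (Int.cast : ℤ → ℚ) *ᵥ (γi *ᵥ v)) i : ℚ) : ℝ) - ((v i : ℚ) : ℝ) = ((n i : ℤ) : ℝ)) := by
      rw [← hcast, hni]; ring
    exact_mod_cast hreal
  have hzero := eq_zero_of_forall_mulVec_int _ hN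
  rw [sub_eq_zero] at hzero
  -- `M γ⁻¹ = 1 ⇒ M = γ`
  have : M.map (Int.cast : ℤ → ℚ) = M.map (Int.cast : ℤ → ℚ) * γi * (γq : Matrix (Fin g ⊕ Fin g) (Fin g ⊕ Fin g) ℚ) := by
    rw [Matrix.mul_assoc, hγi, ← Units.val_mul, inv_mul_cancel, Units.val_one, Matrix.mul_one]
  rw [this, hzero, Matrix.one_mul]

/-! ### §2 (β3F): the type frame of the quotient's polarisation -/

/-- **(β3F) THE TYPE FRAME OF THE HECKE QUOTIENT'S POLARISATION** (module docstring, §2): in the setting there, for every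
divisor `Θ` on `B` with `ψ^*Θ ≡ ν•Θ′` modulo `Pic⁰` (every translate of `ψ^*Θ − ν•Θ′` linearly equivalent to it) there is an
Appell–Humbert datum `p_B` of `[𝒪_B(Θ)^an]` on `m_B`'s own uniformisation with `intGram m_B.Ψ p_B.form = typeForm δ` — the
`p, hp, hT` inputs of ★ `isAdmissibleAt_of_levelReading_of_intGram_eq_typeForm` for the quotient.
[cite: Milne2005ShimuraVarieties, §6 Thm. 6.11 p. 74 and p. 75] [cite: Lange2023AbelianVarietiesComplex, §1.3.3 Lemma 1.3.6, p. 32]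
[cite: MumfordAV1970, §8 (the divisor class `t_x^*D − D`)] -/
theorem quotient_typeFrame (hδ : IsPolarizationType δ) (hg : 0 < g) {N' : ℕ} (hN' : N' ≠ 0)
    {Z Z' : Matrix (Fin g) (Fin g) ℂ} (hZ : Z ∈ siegelUpperHalfSpace g) (hZ' : Z' ∈ siegelUpperHalfSpace g)
    {r r' : gspFinAdelic δ} (hr' : r' ∈ principalLevelSubgroup δ 1) (γq : GL (Fin g ⊕ Fin g) ℚ) (ν : ℕ)
    (hQA3 : (γq : Matrix (Fin g ⊕ Fin g) (Fin g ⊕ Fin g) ℚ)ᵀ * typeFormOver δ ℚ *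
      (γq : Matrix (Fin g ⊕ Fin g) (Fin g ⊕ Fin g) ℚ) = (ν : ℚ) • typeFormOver δ ℚ)
    (P' : PolarizedAbelianSchemeWithLevel g N' δ (specOver ℚ ℂ).left) (B : AbelianVariety ℂ)
    (ψ : (P'.A.fibre (𝟙 (Spec (CommRingCat.of ℂ)))).toAbelianVariety ⟶ B) [IsDominant ψ.hom.hom.hom.left]
    (m : SiegelAdelicMarking ⟨jOfSiegel δ Z, SiegelComplexRecordSystem.jOfSiegel_mem_C0pm hδ.1 hZ⟩ r'
      (P'.A.fibre (𝟙 (Spec (CommRingCat.of ℂ)))).toAbelianVariety) (hmγ : m.γ = 1)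
    (mB : SiegelAdelicMarking ⟨jOfSiegel δ Z', SiegelComplexRecordSystem.jOfSiegel_mem_C0pm hδ.1 hZ'⟩ r B)
    (hmBγ : mB.γ = 1)
    (hmB : ∀ v : Fin g ⊕ Fin g → ℚ, mB.r v = AlgPoints.map ψ.hom.hom.hom
        (m.r ((((γq⁻¹ : GL (Fin g ⊕ Fin g) ℚ) : Matrix (Fin g ⊕ Fin g) (Fin g ⊕ Fin g) ℚ)) *ᵥ v)))
    (Θ' : CartierDivisor (P'.A.fibre (𝟙 (Spec (CommRingCat.of ℂ)))).toAbelianVariety.X.left) (hΘ' : Θ'.IsAmple)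
    (hlam' : P'.A.IsLambdaOfAt (𝟙 (Spec (CommRingCat.of ℂ))) P'.D P'.pol.lam Θ')
    (Λ' : P'.level.SymplecticLift (𝟙 (Spec (CommRingCat.of ℂ))) Θ' δ)
    (hΛ' : ∀ ⦃M : ℕ⦄, N' ∣ M → M ≠ 0 → ∀ (x : Fin g ⊕ Fin g → ZMod M) (v : Fin g ⊕ Fin g → ℚ),
        AdelicCongr ((r'⁻¹ : gspFinAdelic δ) : GL (Fin g ⊕ Fin g) finAdeleQ) 1 v (fun i => ((x i).val : ℚ) / M) →
          ((Λ'.lift M (Multiplicative.ofAdd x)) :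
            (P'.A.fibre (𝟙 (Spec (CommRingCat.of ℂ)))).toAbelianVariety.Points ℂ) = m.r v)
    (Θ : CartierDivisor B.X.left)
    (hW : ∀ x : (P'.A.fibre (𝟙 (Spec (CommRingCat.of ℂ)))).toAbelianVariety.Points ℂ,
      (((Θ.pullback ψ.hom.hom.hom.left + -(ν • Θ')).pullback
        ((P'.A.fibre (𝟙 (Spec (CommRingCat.of ℂ)))).toAbelianVariety.translation x).left).LinEquiv
        (Θ.pullback ψ.hom.hom.hom.left + -(ν • Θ')))) :
    ∃ p : AHData mB.Ψ, AHData.toPic p = picClass (cartierDivisorLineBundle mB.isAnalytification Θ) ∧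
      intGram mB.Ψ p.form = typeForm δ := by
  -- (F1) the source frame
  obtain ⟨p', hp', hT'⟩ := exists_ahData_intGram_eq_typeForm_of_symplecticLift P'.pol hδ hg hN' P'.hasType hlam' hΘ'
    hr' hZ m hmγ Λ' hΛ'
  -- GAGA: the integer matrix of `ψ` and its analytic representation
  obtain ⟨M, hMmem, hM⟩ := Motives.AbelianVariety.exists_mem_homInt_map_eq m.isAnalytification mB.isAnalytification
    m.toFun_zero mB.toFun_zero ψ
  obtain ⟨F, hF⟩ := (mem_homInt_iff_exists_analyticRep m.Ψ mB.Ψ).1 hMmem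
  have hMγ : M.map (Int.cast : ℤ → ℚ) = (γq : Matrix (Fin g ⊕ Fin g) (Fin g ⊕ Fin g) ℚ) :=
    map_intCast_eq_of_quotientMarking hδ hZ hZ' γq m hmγ mB hmBγ ψ hmB hM
  -- an AH datum of `[𝒪_B(Θ)^an]`
  obtain ⟨pB, hpB⟩ := AHData.toPic_surjective (Φ := mB.Ψ) (picClass (cartierDivisorLineBundle mB.isAnalytification Θ))
  refine ⟨pB, hpB, ?_⟩
  -- `c₁(ψ^*Θ) = F^* c₁(Θ)`
  have hpull : Pic.nsForm (picClass (cartierDivisorLineBundle m.isAnalytification (Θ.pullback ψ.hom.hom.hom.left))) =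
      pullbackForm F pB.form := by
    rw [picClass_cartierDivisorLineBundle_pullback_hom' m.isAnalytification mB.isAnalytification ψ M hF hM Θ,
      Pic.nsForm_pullback, ← hpB, AHData.nsForm_toPic]
  -- (W‴): `[𝒪(ψ^*Θ − νΘ′)^an] ∈ Pic⁰`, so `F^* c₁(Θ) = ν • c₁(Θ′)`
  have hzero := picClass_cartierDivisorLineBundle_mem_picZero' m.isAnalytification m.toFun_add _ hW
  rw [mem_picZero_iff, picClass_cartierDivisorLineBundle_add, picClass_cartierDivisorLineBundle_neg,
    picClass_cartierDivisorLineBundle_nsmul, Pic.nsForm_mul, Pic.nsForm_inv, hpull] at hzero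
  have hνform : pullbackForm F pB.form = ν • p'.form := by
    have hΘ'form : Pic.nsForm (picClass (cartierDivisorLineBundle m.isAnalytification Θ')) = p'.form := by
      rw [← hp', AHData.nsForm_toPic]
    have hpow : ∀ k : ℕ, Pic.nsForm (picClass (cartierDivisorLineBundle m.isAnalytification Θ') ^ k) = k • p'.form := by
      intro k
      induction k with
      | zero => rw [pow_zero, Pic.nsForm_one, zero_smul]
      | succ k ih => rw [pow_succ, Pic.nsForm_mul, ih, hΘ'form, add_smul, one_smul]
    rw [hpow ν] at hzero
    exact (add_neg_eq_zero.1 hzero)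
  -- Gram matrices: `ᵗM G_B M = ν E_δ` over `ℝ`
  have hGram : (M.map (Int.cast : ℤ → ℝ))ᵀ * latticeGram mB.Ψ pB.form * M.map (Int.cast : ℤ → ℝ) =
      (ν : ℝ) • ((typeForm δ).map (Int.cast : ℤ → ℝ)) := by
    rw [← latticeGram_pullbackForm_of_real mB.Ψ m.Ψ F hF pB.form, hνform]
    have hns : latticeGram m.Ψ (ν • p'.form) = (ν : ℝ) • latticeGram m.Ψ p'.form := by
      ext i j
      rw [latticeGram_apply, Matrix.smul_apply, latticeGram_apply, ContinuousAlternatingMap.smul_apply,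
        nsmul_eq_mul, smul_eq_mul]
    rw [hns, ← map_intGram m.Ψ p'.isNSForm_form, hT']
  -- `M = γ` and (QA3) `ᵗγ E γ = ν E` give `G_B = E`
  have hMR : M.map (Int.cast : ℤ → ℝ) = (γq : Matrix (Fin g ⊕ Fin g) (Fin g ⊕ Fin g) ℚ).map (Rat.cast : ℚ → ℝ) := by
    rw [← hMγ, Matrix.map_map]; ext a b; simp only [Matrix.map_apply, Function.comp_apply, Rat.cast_intCast]
  have hQA3R : ((γq : Matrix (Fin g ⊕ Fin g) (Fin g ⊕ Fin g) ℚ).map (Rat.cast : ℚ → ℝ))ᵀ * (typeForm δ).map (Int.cast : ℤ → ℝ) *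
      (γq : Matrix (Fin g ⊕ Fin g) (Fin g ⊕ Fin g) ℚ).map (Rat.cast : ℚ → ℝ) = (ν : ℝ) • (typeForm δ).map (Int.cast : ℤ → ℝ) := by
    have h : ((γq : Matrix (Fin g ⊕ Fin g) (Fin g ⊕ Fin g) ℚ)ᵀ * typeFormOver δ ℚ *
        (γq : Matrix (Fin g ⊕ Fin g) (Fin g ⊕ Fin g) ℚ)).map (Rat.cast : ℚ → ℝ) =
        ((ν : ℚ) • typeFormOver δ ℚ).map (Rat.cast : ℚ → ℝ) := by rw [hQA3]
    have hE : (typeFormOver δ ℚ).map (Rat.cast : ℚ → ℝ) = (typeForm δ).map (Int.cast : ℤ → ℝ) := by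
      rw [typeFormOver, Matrix.map_map]; ext a b
      simp only [Matrix.map_apply, Function.comp_apply, eq_intCast, Rat.cast_intCast]
    have hmul : ∀ X Y : Matrix (Fin g ⊕ Fin g) (Fin g ⊕ Fin g) ℚ,
        (X * Y).map (Rat.cast : ℚ → ℝ) = X.map (Rat.cast : ℚ → ℝ) * Y.map (Rat.cast : ℚ → ℝ) := fun X Y =>
      Matrix.map_mul (f := Rat.castHom ℝ)
    have hsm : ((ν : ℚ) • typeFormOver δ ℚ).map (Rat.cast : ℚ → ℝ) = (ν : ℝ) • (typeFormOver δ ℚ).map (Rat.cast : ℚ → ℝ) := by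
      ext a b; simp only [Matrix.map_apply, Matrix.smul_apply, smul_eq_mul, Rat.cast_mul, Rat.cast_natCast]
    rw [hmul, hmul, Matrix.transpose_map, hsm, hE] at h
    exact h
  -- invertibility of `γ_ℝ`
  have hγunit : IsUnit ((γq : Matrix (Fin g ⊕ Fin g) (Fin g ⊕ Fin g) ℚ).map (Rat.cast : ℚ → ℝ)) := by
    have := (γq.isUnit).map (Rat.castHom ℝ).mapMatrix
    simpa using this
  have hGeq : latticeGram mB.Ψ pB.form = (typeForm δ).map (Int.cast : ℤ → ℝ) := by
    rw [hMR] at hGram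
    rw [← hQA3R] at hGram
    -- cancel `γ_ℝ` on the right and `γ_ℝᵀ` on the left
    have h1 := hγunit.mul_right_cancel hGram
    exact ((Matrix.isUnit_transpose _).2 hγunit).mul_left_cancel h1
  exact intGram_eq_of_map_eq pB.isNSForm_form hGeq.symm

end Literature.AlgebraicGeometry.ModuliOfAbelianVarieties

end
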